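import Summits.QuantumFields.YangMills.Theorems.CovariantDischargeCombFrameSweep
import Summits.QuantumFields.YangMills.Theorems.CovariantDischargeCombLassoStokes
import Summits.QuantumFields.YangMills.Theorems.CovariantDischargeFramedFactorFirstOrder
import HarnessLib

/-!
# Line «sandwich_discharge» on crux `HistoryTailL` (stmt-QuantumFields-19936), stub `stub_sandwichSweepGapCapped` — GLUE-B1′:
# THE ACTION LOWER BOUND OF THE COMB-FRAMED SWEEP IN THE `linCobd` CURRENCY

Cell `ym3-torus` (YM ladder rung R3 = continuum SU(2) Yang–Mills on the three-torus — a RUNG, NOT the Clay problem: not d = 4, not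
infinite volume, not a mass gap), width seat `ym-ust-19936-w5` gen 14, helper letters `--supports stmt-QuantumFields-19936`.

WHY.  The B6 door of `stub_sandwichSweepGapCapped` (px8 g7, ARCH-S′ v2 (19936 evidence #59) and v3 «WHICH CURRENCY») undoes the comb-framed
one-axis sweep `Ψ` of ✓`CovariantDischargeCombFrameSweep.exists_sweep_pair_comb` (`Ψ′U = (b ↦ n_b(U)⁻¹·U_b on S)`,
`n_b(U) = expPoint(cb_b • Ad_{(axialT U c b.src)⁻¹} n̂₀)`) and needs a lower bound for `A(V) − A(Ψ′V)` whose FIRST-ORDER frame defect is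
paired with the plaquette deviation `V(∂q) − 1` (v3 D4: the quaternion-currency defect row of ✓`CovariantDischargeFramedSweepAction` lacks that
factor and is unaffordable for the door).  This file composes the landed B1′ letters into exactly that bound:
✓`CovariantDischargeSweepSharpQuadraticCost.lin_sub_sharp_le_wilsonAction4_sub_mulField` (the sharp main letter, `Λ_q = nReTr(linCobd_q·(V(∂q) − 1))`),
✓`CovariantDischargeFramedSweepLinCobd.norm_linCobd_sub_conj_le` (the framed `linCobd` to first order),
✓`CovariantDischargeFramedFactorFirstOrder.norm_framedFactor_sub_le` (`qᵢ = 2cᵢ²`), ✓`CovariantDischargeCombLassoStokes.dist1_gaugeAct_axialT_le_of_ball`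
(the frame loops are comb-gauge links, `≤ η_r`).
* §1 `sweepInv_eq_mulField`, `combFactor_eq_expPoint` — `Ψ′V = E(V)·V`, `E_b(V) = expPoint(c_b • Ad_{(axialT V c b.src)⁻¹} n̂₀)`, `c_b = −cb_b` on `S`, `0` off `S`;
* §2 `nReTr_quatMatrix_imQuat_mul_sub_one` (`nReTr(quatMatrix(ι x)·(H − 1)) = −⟨x, imVec su2Quat H⟩`), `nReTr_framedPattern_mul_sub_one`,
  ★`nReTr_combPattern_mul_sub_one` — the one-axis pattern in the comb frame pairs with `V(∂q) − 1` as MINUS the fixed-frame reading of the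
  re-gauged plaquette `W̃(∂q) = (V^{axialT V c})(∂q)`;
* §3 `natAbs_sub_e_le`, `frameLoops_le` — the frame loops of a plaquette with letters in the ball are `≤ η`, `≤ 3η`, `η := ((2d(r+1)+2)²∕4)·θ`;
* §4 ★★ `norm_linCobd_comb_sub_le` — per plaquette: `‖linCobd_q − G_x·quatMatrix(ι(s_q•n̂₀))·G_x⁻¹‖ ≤ D_q`,
  `D_q := 2Σᵢc(bᵢ)² + 2(|c(b₂)|η + 3|c(b₃)|η + |c(b₄)|θ)`, `s_q := c(b₁)+c(b₂)−c(b₃)−c(b₄)`, `G_x := (axialT V c x_q)⁻¹`;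
* §5 ★★★ `comb_pairing_sub_le_wilsonAction4_sub_mulField` and ★★★ `comb_pairing_sub_le_wilsonAction4_sub_sweepInv` — THE GLUE:
  `Σ_q (−s_q·⟨n̂₀, imVec su2Quat W̃(∂q)⟩ − D_q·dist1 V(∂q)) − r(t)·Σ_q dist1 V(∂q) − ½Σ_q (|s_q| + D_q + r(t))² ≤ A(V) − A(Ψ′V)`,
  `r(t) = 6t²+4t³+t⁴`, `|c_b| ≤ t ≤ 1`.
HONEST SCOPE: deterministic per-configuration algebra under `PlaqSmall θ V`; nothing here chooses the profile `cb`, bounds the signal, or does the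
knit arithmetic; nothing of `stub_sandwichSweepGapCapped`, `HistoryTailL` or any summit statement is proved or claimed.
[cite: Balaban1985Averaging, (8)-(10) p.19, (19)-(20) p.21, p.24; Balaban1987RG1, (0.2) p.252; Balaban1989LargeFieldI, (1.77) p.194]
-/

noncomputable section

open scoped BigOperators RealInnerProductSpace Quaternion Matrix.Norms.L2Operator
open Literature.MathematicalPhysics.QuantumLattice (su2Quat quatMatrix quatMatrix_su2Quat quatMatrix_one quatMatrix_mul)
open Literature.MathematicalPhysics.QuantumFieldTheory.Balaban1983to89
open Literature.MathematicalPhysics.QuantumFieldTheory.Balaban1983to89.T4CubeChartGnomonic (SU2)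
open Literature.MathematicalPhysics.QuantumFieldTheory.Balaban1983to89.T4HaarSU2ExpChart (imQuat expPoint expPoint_zero imQuat_re)
open Literature.MathematicalPhysics.QuantumFieldTheory.Balaban1983to89.T4ExpWindowSmallField (imVec)
open Literature.MathematicalPhysics.QuantumFieldTheory.Balaban1983to89.T4QuatExpLog (quatMatrix_sub)
open Literature.MathematicalPhysics.QuantumFieldTheory.Balaban1983to89.T4WilsonLinkAffine (bond₁ bond₂ bond₃ bond₄)
open Literature.MathematicalPhysics.QuantumFieldTheory.Balaban1983to89.T4WilsonGaugeFlatDirection (plaqHol_gaugeAct)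
open Literature.MathematicalPhysics.QuantumFieldTheory.Balaban1983to89.B15Prop1ChartSU2 (adSU2)
open Literature.MathematicalPhysics.QuantumFieldTheory.Balaban1983to89.B10Eq27TorusAxialLog (transl axialT transl_add_e transl_sub_e)
open Literature.MathematicalPhysics.QuantumFieldTheory.Balaban1983to89.B7Prop1Explicit (e e_apply)
open Literature.MathematicalPhysics.QuantumFieldTheory.Balaban1983to89.UnitaryModel (nReTr)
open Literature.MathematicalPhysics.QuantumFieldTheory.Balaban1983to89.T4TiltOscillation (nReTr_sub)
open Summit.QuantumFields.YangMills.Theorems.ApproxLift (mulField mulField_apply linCobd)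
open Summit.QuantumFields.YangMills.Theorems.CovariantDischargeSweepActionVariation (abs_nReTr_mul_sub_one_le)
open Summit.QuantumFields.YangMills.Theorems.CovariantDischargeSweepSharpQuadraticCost (lin_sub_sharp_le_wilsonAction4_sub_mulField)
open Summit.QuantumFields.YangMills.Theorems.CovariantDischargeUniformFluxLetters (expPoint_neg_smul)
open Summit.QuantumFields.YangMills.Theorems.CovariantDischargeOneLinkIncrement (re_imQuat_mul)
open Summit.QuantumFields.YangMills.Theorems.CovariantDischargeFramedPlaquetteTransport (gaugeAct_threePath_eq expPoint_smul_adSU2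
  dist1_expPoint_smul_le)
open Summit.QuantumFields.YangMills.Theorems.CovariantDischargeFramedSweepLinCobd (norm_conj_eq norm_linCobd_sub_conj_le nReTr_conj_mul_sub_one)
open Summit.QuantumFields.YangMills.Theorems.CovariantDischargeFramedFactorFirstOrder (norm_framedFactor_sub_le norm_framedFactor_inv_sub_le
  quatMatrix_imQuat_plaqPattern norm_quatMatrix_imQuat_smul)
open Summit.QuantumFields.YangMills.Theorems.CovariantDischargeCombLassoStokes (dist1_gaugeAct_axialT_le_of_ball)

namespace Summit.QuantumFields.YangMills.Theorems.CovariantDischargeCombSweepLinCobd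

variable {P : Params} {j : ℕ}

/-! ## §1 The undoing of the comb sweep is a framed bondwise left product -/

section Sweep

variable [DecidableEq (PBond P j)]

/-- `Ψ′ U = E(U)·U` with `E_b(U) = n_b(U)⁻¹` on `S`, `1` off `S`. [folklore] -/
theorem sweepInv_eq_mulField (S : Finset (PBond P j)) (nf : PBond P j → GaugeField P j SU2 → SU2)
    (Ψ' : GaugeField P j SU2 → GaugeField P j SU2) (hΨ' : ∀ U b, Ψ' U b = if b ∈ S then (nf b U)⁻¹ * U b else U b)
    (U : GaugeField P j SU2) :
    Ψ' U = mulField (fun b => if b ∈ S then (nf b U)⁻¹ else 1) U := by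
  funext b
  rw [hΨ', mulField_apply]
  split_ifs <;> simp

/-- The framed factors of `Ψ′`: `E_b(U) = expPoint(c_b • Ad_{(axialT U c b.src)⁻¹} n̂₀)` with `c_b = −cb_b` on `S`, `0` off `S`.
[cite: Balaban1989LargeFieldI, (1.77) p.194] -/
theorem combFactor_eq_expPoint (c : Site P j) (n : EuclideanSpace ℝ (Fin 3)) (cb : PBond P j → ℝ) (S : Finset (PBond P j))
    (nf : PBond P j → GaugeField P j SU2 → SU2) (hnf : ∀ b U, nf b U = expPoint (cb b • adSU2 (axialT U c b.src)⁻¹ n))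
    (U : GaugeField P j SU2) (b : PBond P j) :
    (if b ∈ S then (nf b U)⁻¹ else 1) =
      expPoint ((if b ∈ S then -cb b else 0) • adSU2 (axialT U c b.src)⁻¹ n) := by
  split_ifs
  · rw [hnf, ← expPoint_neg_smul, neg_smul]
  · rw [zero_smul, expPoint_zero]

end Sweep

/-! ## §2 The one-axis pattern pairs with the plaquette deviation as the fixed-frame reading -/

/-- `nReTr (quatMatrix q) = re q` (normalised real trace on `2 × 2`). [folklore] -/
private theorem nReTr_quatMatrix_eq (q : ℍ) : nReTr (quatMatrix q) = q.re := by
  have h : ((quatMatrix q).trace).re = 2 * q.re := by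
    rw [Matrix.trace_fin_two, Literature.MathematicalPhysics.QuantumLattice.quatMatrix_apply_00,
      Literature.MathematicalPhysics.QuantumLattice.quatMatrix_apply_11, Complex.add_re]
    ring
  unfold nReTr
  rw [h, Fintype.card_fin]
  push_cast
  ring

/-- `nReTr(quatMatrix(ι x)·(H − 1)) = −⟨x, imVec(su2Quat H)⟩` — the pattern `ι x` paired with the deviation `H − 1` of `H ∈ SU(2)` is minus the
`x`-reading of `H` (`Re(ι x) = 0` kills the `−1`). [cite: Balaban1985Averaging, (20) p.21] -/
theorem nReTr_quatMatrix_imQuat_mul_sub_one (x : EuclideanSpace ℝ (Fin 3)) (H : SU2) :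
    nReTr (quatMatrix (imQuat x) * ((H : Matrix (Fin 2) (Fin 2) ℂ) - 1)) = -⟪x, imVec (su2Quat H)⟫ := by
  rw [← quatMatrix_su2Quat, ← quatMatrix_one, ← quatMatrix_sub, ← quatMatrix_mul, nReTr_quatMatrix_eq, mul_sub, mul_one,
    Quaternion.re_sub, imQuat_re, sub_zero, re_imQuat_mul]

/-- Framed: `nReTr(G·quatMatrix(ι x)·G⁻¹·(H − 1)) = −⟨x, imVec(su2Quat(G⁻¹HG))⟩`. [cite: Balaban1985Averaging, (8) p.19, (20) p.21] -/
theorem nReTr_framedPattern_mul_sub_one (G H : SU2) (x : EuclideanSpace ℝ (Fin 3)) :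
    nReTr ((G : Matrix (Fin 2) (Fin 2) ℂ) * quatMatrix (imQuat x) * ((G⁻¹ : SU2) : Matrix (Fin 2) (Fin 2) ℂ) *
        ((H : Matrix (Fin 2) (Fin 2) ℂ) - 1)) = -⟪x, imVec (su2Quat (G⁻¹ * H * G))⟫ := by
  rw [nReTr_conj_mul_sub_one, nReTr_quatMatrix_imQuat_mul_sub_one]

/-- ★ COMB: with the frame `G_x = u(x)⁻¹` of a gauge `u` at the plaquette corner, the pattern pairs with `U(∂q) − 1` as minus the
fixed-frame reading of the RE-GAUGED plaquette `U^u(∂q) = u(x)·U(∂q)·u(x)⁻¹`. [cite: Balaban1985Averaging, (8)-(9) p.19, (20) p.21] -/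
theorem nReTr_combPattern_mul_sub_one (u : GaugeTransf P j SU2) (U : GaugeField P j SU2) (q : Plaq P j)
    (x : EuclideanSpace ℝ (Fin 3)) :
    nReTr ((((u q.src)⁻¹ : SU2) : Matrix (Fin 2) (Fin 2) ℂ) * quatMatrix (imQuat x) * ((u q.src : SU2) : Matrix (Fin 2) (Fin 2) ℂ) *
        (((GaugeField.plaqHol U q : SU2) : Matrix (Fin 2) (Fin 2) ℂ) - 1)) =
      -⟪x, imVec (su2Quat (GaugeField.plaqHol (GaugeField.gaugeAct u U) q))⟫ := by
  have h := nReTr_framedPattern_mul_sub_one (u q.src)⁻¹ (GaugeField.plaqHol U q) x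
  rw [inv_inv] at h
  rw [h, ← plaqHol_gaugeAct]

/-! ## §3 The frame loops of a plaquette with letters in the ball -/

/-- Window arithmetic: `‖z + s•e_μ‖_∞ ≤ r + 1` when `‖z‖_∞ ≤ r`, `|s| ≤ 1`. [folklore] -/
theorem natAbs_sub_e_le {r : ℕ} {z : Fin P.d → ℤ} (hz : ∀ ν, (z ν).natAbs ≤ r) (μ : Fin P.d) (s : ℤ) (hs : s.natAbs ≤ 1) :
    ∀ ν, ((z + s • e μ) ν).natAbs ≤ r + 1 := by
  intro ν
  rw [Pi.add_apply, Pi.smul_apply, smul_eq_mul, e_apply]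
  have h := hz ν
  split_ifs <;> omega

/-- The frame loops of a plaquette whose corner is `c + w`, `‖w‖_∞, ‖w + e_μ‖_∞, ‖w + e_ν‖_∞ ≤ r + 1`, priced by the comb-lasso letter:
`dist1(V^u(b₁)) ≤ η`, `dist1(V^u(b₁)V^u(b₂)V^u(b₃)⁻¹) ≤ 3η`, `u := axialT V c`, `η = ((2d(r+1)+2)²/4)·θ`. [cite: Balaban1985Averaging, (19)-(20) p.21, p.24] -/
theorem frameLoops_le {θ : ℝ} (hθ : 0 ≤ θ) {V : GaugeField P j SU2} (hV : PlaqSmall θ V) (c : Site P j) {r : ℕ}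
    (hr : 2 * (r + 1 + 1) ≤ P.sitesPerDir j) (q : Plaq P j) {w : Fin P.d → ℤ} (hw : ∀ ν, (w ν).natAbs ≤ r + 1)
    (hq : q.src = transl c w) (hw₂ : ∀ ν, ((w + e q.μ) ν).natAbs ≤ r + 1) (hw₃ : ∀ ν, ((w + e q.ν) ν).natAbs ≤ r + 1) :
    dist1 (GaugeField.gaugeAct (axialT V c) V (bond₁ q)) ≤ (((2 * P.d * (r + 1) + 2 : ℕ) : ℝ) ^ 2 / 4) * θ ∧
    dist1 (GaugeField.gaugeAct (axialT V c) V (bond₁ q) * GaugeField.gaugeAct (axialT V c) V (bond₂ q) *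
        (GaugeField.gaugeAct (axialT V c) V (bond₃ q))⁻¹) ≤ 3 * ((((2 * P.d * (r + 1) + 2 : ℕ) : ℝ) ^ 2 / 4) * θ) := by
  have h₁ := dist1_gaugeAct_axialT_le_of_ball hθ hV c hr hw (bond₁ q) hq
  have h₂ := dist1_gaugeAct_axialT_le_of_ball hθ hV c hr hw₂ (bond₂ q) (by rw [bond₂, hq, transl_add_e])
  have h₃ := dist1_gaugeAct_axialT_le_of_ball hθ hV c hr hw₃ (bond₃ q) (by rw [bond₃, hq, transl_add_e])
  refine ⟨h₁, ?_⟩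
  have hm := GaugeGroup.dist1_mul_le (GaugeField.gaugeAct (axialT V c) V (bond₁ q) * GaugeField.gaugeAct (axialT V c) V (bond₂ q))
    (GaugeField.gaugeAct (axialT V c) V (bond₃ q))⁻¹
  have hm' := GaugeGroup.dist1_mul_le (GaugeField.gaugeAct (axialT V c) V (bond₁ q)) (GaugeField.gaugeAct (axialT V c) V (bond₂ q))
  rw [GaugeGroup.dist1_inv] at hm
  linarith

/-! ## §4 Per plaquette: the comb-framed `linCobd` against the one-axis pattern -/

/-- ★★ **THE COMB-FRAMED LINEARISED COBOUNDARY TO FIRST ORDER.**  For factors `E_b = expPoint(c_b • Ad_{(axialT V c b.src)⁻¹} n̂₀)`,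
`‖n̂₀‖ = 1`, `|c_b| ≤ 1`, with every `b` carrying `c_b ≠ 0` sourced in the ball `{c + z : ‖z‖_∞ ≤ r}`, `2(r+2) ≤` period, `PlaqSmall θ V`:
`‖linCobd E V q − G_x·quatMatrix(ι(s_q • n̂₀))·G_x⁻¹‖ ≤ 2Σᵢ c(bᵢ)² + 2(|c(b₂)|·η + |c(b₃)|·3η + |c(b₄)|·θ)`, `G_x = (axialT V c x_q)⁻¹`,
`s_q = c(b₁)+c(b₂)−c(b₃)−c(b₄)`, `η = ((2d(r+1)+2)²/4)·θ` — (r2-M) with `qᵢ = 2cᵢ²` ((R2-q)) and the frame loops read as comb-gauge links ((ii)).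
[cite: Balaban1985Averaging, (19)-(20) p.21, p.24; Balaban1989LargeFieldI, (1.77) p.194] -/
theorem norm_linCobd_comb_sub_le {θ : ℝ} (hθ : 0 ≤ θ) {V : GaugeField P j SU2} (hV : PlaqSmall θ V) (c : Site P j) {r : ℕ}
    (hr : 2 * (r + 2) ≤ P.sitesPerDir j) {n : EuclideanSpace ℝ (Fin 3)} (hn : ‖n‖ = 1) (E : GaugeField P j SU2)
    (cf : PBond P j → ℝ) (hE : ∀ b, E b = expPoint (cf b • adSU2 (axialT V c b.src)⁻¹ n))
    (hcf : ∀ b, cf b ≠ 0 → ∃ z : Fin P.d → ℤ, (∀ ν, (z ν).natAbs ≤ r) ∧ b.src = transl c z) (h1 : ∀ b, |cf b| ≤ 1)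
    (q : Plaq P j) :
    ‖linCobd E V q - (((axialT V c q.src)⁻¹ : SU2) : Matrix (Fin 2) (Fin 2) ℂ) *
        quatMatrix (imQuat ((cf (bond₁ q) + cf (bond₂ q) - cf (bond₃ q) - cf (bond₄ q)) • n)) *
        ((axialT V c q.src : SU2) : Matrix (Fin 2) (Fin 2) ℂ)‖ ≤
      2 * (cf (bond₁ q) ^ 2 + cf (bond₂ q) ^ 2 + cf (bond₃ q) ^ 2 + cf (bond₄ q) ^ 2) +
        2 * (|cf (bond₂ q)| * ((((2 * P.d * (r + 1) + 2 : ℕ) : ℝ) ^ 2 / 4) * θ) +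
          |cf (bond₃ q)| * (3 * ((((2 * P.d * (r + 1) + 2 : ℕ) : ℝ) ^ 2 / 4) * θ)) + |cf (bond₄ q)| * θ) := by
  -- the four framed-factor hypotheses of (r2-M), discharged by (R2-q)
  have hE₁ : E ⟨q.src, q.μ⟩ = expPoint (cf (bond₁ q) • adSU2 (axialT V c q.src)⁻¹ n) := hE _
  have hE₂ : E ⟨q.src.shift q.μ, q.ν⟩ = expPoint (cf (bond₂ q) • adSU2 (axialT V c (q.src.shift q.μ))⁻¹ n) := hE _
  have hE₃ : E ⟨q.src.shift q.ν, q.μ⟩ = expPoint (cf (bond₃ q) • adSU2 (axialT V c (q.src.shift q.ν))⁻¹ n) := hE _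
  have hE₄ : E ⟨q.src, q.ν⟩ = expPoint (cf (bond₄ q) • adSU2 (axialT V c q.src)⁻¹ n) := hE _
  have h₁ := norm_framedFactor_sub_le (axialT V c q.src)⁻¹ hn (h1 (bond₁ q))
  have h₂ := norm_framedFactor_sub_le (axialT V c (q.src.shift q.μ))⁻¹ hn (h1 (bond₂ q))
  have h₃ := norm_framedFactor_inv_sub_le (axialT V c (q.src.shift q.ν))⁻¹ hn (h1 (bond₃ q))
  have h₄ := norm_framedFactor_inv_sub_le (axialT V c q.src)⁻¹ hn (h1 (bond₄ q))
  rw [← hE₁] at h₁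
  rw [← hE₂] at h₂
  rw [← hE₃] at h₃
  rw [← hE₄] at h₄
  have hmain := norm_linCobd_sub_conj_le E V q (axialT V c q.src)⁻¹ (axialT V c (q.src.shift q.μ))⁻¹
    (axialT V c (q.src.shift q.ν))⁻¹ (axialT V c q.src)⁻¹ _ _ _ _ h₁ h₂ h₃ h₄
  rw [quatMatrix_imQuat_plaqPattern, norm_quatMatrix_imQuat_smul hn, norm_quatMatrix_imQuat_smul hn,
    norm_quatMatrix_imQuat_smul hn, inv_inv] at hmain
  refine hmain.trans ?_
  -- the three transports are comb-gauge loops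
  have e₂ : axialT V c q.src * V ⟨q.src, q.μ⟩ * (axialT V c (q.src.shift q.μ))⁻¹ =
      GaugeField.gaugeAct (axialT V c) V (bond₁ q) := rfl
  have e₃ : axialT V c q.src * (V ⟨q.src, q.μ⟩ * V ⟨q.src.shift q.μ, q.ν⟩ * (V ⟨q.src.shift q.ν, q.μ⟩)⁻¹) *
      (axialT V c (q.src.shift q.ν))⁻¹ =
      GaugeField.gaugeAct (axialT V c) V (bond₁ q) * GaugeField.gaugeAct (axialT V c) V (bond₂ q) *
        (GaugeField.gaugeAct (axialT V c) V (bond₃ q))⁻¹ := (gaugeAct_threePath_eq _ _ _).symm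
  have e₄ : dist1 (axialT V c q.src * GaugeField.plaqHol V q * (axialT V c q.src)⁻¹) = dist1 (GaugeField.plaqHol V q) :=
    GaugeGroup.dist1_conj _ _
  rw [e₂, e₃, e₄]
  set η : ℝ := (((2 * P.d * (r + 1) + 2 : ℕ) : ℝ) ^ 2 / 4) * θ with hη
  have hr' : 2 * (r + 1 + 1) ≤ P.sitesPerDir j := by omega
  have a₂ := abs_nonneg (cf (bond₂ q))
  have a₃ := abs_nonneg (cf (bond₃ q))
  have a₄ := abs_nonneg (cf (bond₄ q))
  -- term 2: if `c(b₂) ≠ 0` its source `x + e_μ` is in the ball, so `x` is in the ball of radius `r + 1`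
  have t₂ : |cf (bond₂ q)| * dist1 (GaugeField.gaugeAct (axialT V c) V (bond₁ q)) ≤ |cf (bond₂ q)| * η := by
    by_cases h0 : cf (bond₂ q) = 0
    · rw [h0, abs_zero, zero_mul, zero_mul]
    · obtain ⟨z, hz, hsrc⟩ := hcf _ h0
      have hx : q.src = transl c (z + (-1 : ℤ) • e q.μ) := by
        rw [neg_one_zsmul, ← sub_eq_add_neg, transl_sub_e, ← hsrc, bond₂, Site.unshift_shift]
      have hw := natAbs_sub_e_le hz q.μ (-1) (by simp)
      exact mul_le_mul_of_nonneg_left (frameLoops_le hθ hV c hr' q hw hx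
        (by intro ν; simp only [Pi.add_apply, Pi.smul_apply, smul_eq_mul, e_apply]; have := hz ν
            split_ifs <;> omega)
        (by intro ν; simp only [Pi.add_apply, Pi.smul_apply, smul_eq_mul, e_apply]; have := hz ν
            split_ifs <;> omega)).1 a₂
  have t₃ : |cf (bond₃ q)| *
      dist1 (GaugeField.gaugeAct (axialT V c) V (bond₁ q) * GaugeField.gaugeAct (axialT V c) V (bond₂ q) *
        (GaugeField.gaugeAct (axialT V c) V (bond₃ q))⁻¹) ≤ |cf (bond₃ q)| * (3 * η) := by
    by_cases h0 : cf (bond₃ q) = 0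
    · rw [h0, abs_zero, zero_mul, zero_mul]
    · obtain ⟨z, hz, hsrc⟩ := hcf _ h0
      have hx : q.src = transl c (z + (-1 : ℤ) • e q.ν) := by
        rw [neg_one_zsmul, ← sub_eq_add_neg, transl_sub_e, ← hsrc, bond₃, Site.unshift_shift]
      have hw := natAbs_sub_e_le hz q.ν (-1) (by simp)
      exact mul_le_mul_of_nonneg_left (frameLoops_le hθ hV c hr' q hw hx
        (by intro ν; simp only [Pi.add_apply, Pi.smul_apply, smul_eq_mul, e_apply]; have := hz ν
            split_ifs <;> omega)
        (by intro ν; simp only [Pi.add_apply, Pi.smul_apply, smul_eq_mul, e_apply]; have := hz ν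
            split_ifs <;> omega)).2 a₃
  have t₄ : |cf (bond₄ q)| * dist1 (GaugeField.plaqHol V q) ≤ |cf (bond₄ q)| * θ := mul_le_mul_of_nonneg_left (hV q).le a₄
  nlinarith [t₂, t₃, t₄]

/-! ## §5 THE GLUE: the comb-framed sweep's action lower bound in the `linCobd` currency -/

/-- ★★★ **THE ACTION LOWER BOUND OF A COMB-FRAMED LEFT PRODUCT, B1′ CURRENCY.**  With `E_b = expPoint(c_b • Ad_{(axialT V c b.src)⁻¹} n̂₀)`,
`‖n̂₀‖ = 1`, `|c_b| ≤ t ≤ 1`, every `b` with `c_b ≠ 0` sourced in the ball `{c + z : ‖z‖_∞ ≤ r}`, `2(r+2) ≤` period, `PlaqSmall θ V`, and the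
abbreviations `s_q = c(b₁)+c(b₂)−c(b₃)−c(b₄)`, `D_q = 2Σᵢc(bᵢ)² + 2(|c(b₂)|η + |c(b₃)|·3η + |c(b₄)|θ)` (passed as functions `s`, `D` with
their defining equations), `r(t) = 6t²+4t³+t⁴`, `W̃ := V^{axialT V c}`:
`Σ_q (−s_q·⟨n̂₀, imVec su2Quat W̃(∂q)⟩ − D_q·dist1 V(∂q)) − r(t)·Σ_q dist1 V(∂q) − ½·Σ_q (|s_q| + D_q + r(t))² ≤ A(V) − A(E·V)` —
✓`lin_sub_sharp_le_wilsonAction4_sub_mulField` with `Λ_q ≥ −s_q·F_q − D_q·dist1 V(∂q)` (§2, §4, ✓`abs_nReTr_mul_sub_one_le`) and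
`‖linCobd_q‖ ≤ |s_q| + D_q`. [cite: Balaban1985Averaging, (10) p.19, (19)-(20) p.21, p.24; Balaban1987RG1, (0.2) p.252] -/
theorem comb_pairing_sub_le_wilsonAction4_sub_mulField {θ : ℝ} (hθ : 0 ≤ θ) {V : GaugeField P j SU2} (hV : PlaqSmall θ V)
    (c : Site P j) {r : ℕ} (hr : 2 * (r + 2) ≤ P.sitesPerDir j) {n : EuclideanSpace ℝ (Fin 3)} (hn : ‖n‖ = 1)
    (E : GaugeField P j SU2) (cf : PBond P j → ℝ) (hE : ∀ b, E b = expPoint (cf b • adSU2 (axialT V c b.src)⁻¹ n))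
    (hcf : ∀ b, cf b ≠ 0 → ∃ z : Fin P.d → ℤ, (∀ ν, (z ν).natAbs ≤ r) ∧ b.src = transl c z)
    {t : ℝ} (ht : ∀ b, |cf b| ≤ t) (ht1 : t ≤ 1) (s D : Plaq P j → ℝ)
    (hs : ∀ q, s q = cf (bond₁ q) + cf (bond₂ q) - cf (bond₃ q) - cf (bond₄ q))
    (hD : ∀ q, D q = 2 * (cf (bond₁ q) ^ 2 + cf (bond₂ q) ^ 2 + cf (bond₃ q) ^ 2 + cf (bond₄ q) ^ 2) +
        2 * (|cf (bond₂ q)| * ((((2 * P.d * (r + 1) + 2 : ℕ) : ℝ) ^ 2 / 4) * θ) +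
          |cf (bond₃ q)| * (3 * ((((2 * P.d * (r + 1) + 2 : ℕ) : ℝ) ^ 2 / 4) * θ)) + |cf (bond₄ q)| * θ)) :
    (∑ q : Plaq P j,
        (-s q * ⟪n, imVec (su2Quat (GaugeField.plaqHol (GaugeField.gaugeAct (axialT V c) V) q))⟫ -
          D q * dist1 (GaugeField.plaqHol V q))) -
      (6 * t ^ 2 + 4 * t ^ 3 + t ^ 4) * ∑ q : Plaq P j, dist1 (GaugeField.plaqHol V q) -
      1 / 2 * ∑ q : Plaq P j, (|s q| + D q + (6 * t ^ 2 + 4 * t ^ 3 + t ^ 4)) ^ 2 ≤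
      wilsonAction4 V - wilsonAction4 (mulField E V) := by
  have h1 : ∀ b, |cf b| ≤ 1 := fun b => (ht b).trans ht1
  -- the four `dist1 (E ·) ≤ t` of the sharp main letter
  have hd : ∀ b, dist1 (E b) ≤ t := fun b => by
    rw [hE b, expPoint_smul_adSU2, GaugeGroup.dist1_conj]
    exact (dist1_expPoint_smul_le hn _).trans (ht b)
  have hB := lin_sub_sharp_le_wilsonAction4_sub_mulField E V (t := fun _ => t) (fun q => hd _) (fun q => hd _) (fun q => hd _)
    (fun q => hd _)
  refine le_trans ?_ hB
  -- per plaquette: the pairing from below and the norm of `linCobd` from above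
  have key : ∀ q : Plaq P j,
      -s q * ⟪n, imVec (su2Quat (GaugeField.plaqHol (GaugeField.gaugeAct (axialT V c) V) q))⟫ -
          D q * dist1 (GaugeField.plaqHol V q) ≤
        nReTr (linCobd E V q * (((GaugeField.plaqHol V q : SU2) : Matrix (Fin 2) (Fin 2) ℂ) - 1)) ∧
      (‖linCobd E V q‖ + (6 * t ^ 2 + 4 * t ^ 3 + t ^ 4)) ^ 2 ≤ (|s q| + D q + (6 * t ^ 2 + 4 * t ^ 3 + t ^ 4)) ^ 2 := by
    intro q
    have ht0 : 0 ≤ t := (abs_nonneg _).trans (ht (bond₁ q))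
    have hrt0 : 0 ≤ 6 * t ^ 2 + 4 * t ^ 3 + t ^ 4 := by positivity
    -- the pattern and its distance to `linCobd`
    have hdef := norm_linCobd_comb_sub_le hθ hV c hr hn E cf hE hcf h1 q
    rw [← hs q, ← hD q] at hdef
    set X : Matrix (Fin 2) (Fin 2) ℂ := (((axialT V c q.src)⁻¹ : SU2) : Matrix (Fin 2) (Fin 2) ℂ) *
        quatMatrix (imQuat (s q • n)) * ((axialT V c q.src : SU2) : Matrix (Fin 2) (Fin 2) ℂ) with hX
    have hXn : ‖X‖ = |s q| := by
      have h := norm_conj_eq (axialT V c q.src)⁻¹ (quatMatrix (imQuat (s q • n)))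
      rw [inv_inv] at h
      rw [hX, h, norm_quatMatrix_imQuat_smul hn]
    have hpair : nReTr (X * (((GaugeField.plaqHol V q : SU2) : Matrix (Fin 2) (Fin 2) ℂ) - 1)) =
        -s q * ⟪n, imVec (su2Quat (GaugeField.plaqHol (GaugeField.gaugeAct (axialT V c) V) q))⟫ := by
      rw [hX, nReTr_combPattern_mul_sub_one, real_inner_smul_left, neg_mul]
    have hsplit : nReTr (linCobd E V q * (((GaugeField.plaqHol V q : SU2) : Matrix (Fin 2) (Fin 2) ℂ) - 1)) =
        nReTr (X * (((GaugeField.plaqHol V q : SU2) : Matrix (Fin 2) (Fin 2) ℂ) - 1)) +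
          nReTr ((linCobd E V q - X) * (((GaugeField.plaqHol V q : SU2) : Matrix (Fin 2) (Fin 2) ℂ) - 1)) := by
      rw [sub_mul, nReTr_sub]
      ring
    have hrem := abs_nReTr_mul_sub_one_le (linCobd E V q - X) (GaugeField.plaqHol V q)
    have hd0 := GaugeGroup.dist1_nonneg (GaugeField.plaqHol V q)
    have hrem' : -(D q * dist1 (GaugeField.plaqHol V q)) ≤
        nReTr ((linCobd E V q - X) * (((GaugeField.plaqHol V q : SU2) : Matrix (Fin 2) (Fin 2) ℂ) - 1)) := by
      have := (abs_le.mp hrem).1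
      nlinarith [mul_le_mul_of_nonneg_right hdef hd0]
    refine ⟨?_, ?_⟩
    · rw [hsplit, hpair]
      linarith
    · have hle : ‖linCobd E V q‖ ≤ |s q| + D q := by
        have h := norm_le_norm_add_norm_sub' (linCobd E V q) X
        rw [hXn] at h
        linarith
      have h0 : 0 ≤ ‖linCobd E V q‖ + (6 * t ^ 2 + 4 * t ^ 3 + t ^ 4) := add_nonneg (norm_nonneg _) hrt0
      exact pow_le_pow_left₀ h0 (by linarith) 2
  have S₁ := Finset.sum_le_sum fun q (_ : q ∈ (Finset.univ : Finset (Plaq P j))) => (key q).1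
  have S₃ := Finset.sum_le_sum fun q (_ : q ∈ (Finset.univ : Finset (Plaq P j))) => (key q).2
  rw [Finset.mul_sum]
  linarith

/-- ★★★ **THE SAME FOR THE SWEEP PAIR OF ✓`exists_sweep_pair_comb`**: with `Ψ′U = (b ↦ n_b(U)⁻¹·U_b on S)`,
`n_b(U) = expPoint(cb_b • Ad_{(axialT U c b.src)⁻¹} n̂₀)`, sources of `S` in the ball, `|cb_b| ≤ t ≤ 1` on `S`, the factors are
`E_b = expPoint(c_b • …)` with the SIGNED amplitude `c_b = −cb_b` on `S`, `0` off `S`, and §5's bound holds for `A(V) − A(Ψ′V)`.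
[cite: Balaban1985Averaging, (10) p.19, (19)-(20) p.21, p.24; Balaban1987RG1, (0.2) p.252] -/
theorem comb_pairing_sub_le_wilsonAction4_sub_sweepInv [DecidableEq (PBond P j)] {θ : ℝ} (hθ : 0 ≤ θ) {V : GaugeField P j SU2}
    (hV : PlaqSmall θ V) (c : Site P j) {r : ℕ} (hr : 2 * (r + 2) ≤ P.sitesPerDir j) {n : EuclideanSpace ℝ (Fin 3)} (hn : ‖n‖ = 1)
    (S : Finset (PBond P j)) (hS : ∀ b ∈ S, ∃ z : Fin P.d → ℤ, (∀ ν, (z ν).natAbs ≤ r) ∧ b.src = transl c z)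
    (cb : PBond P j → ℝ) (nf : PBond P j → GaugeField P j SU2 → SU2)
    (hnf : ∀ b U, nf b U = expPoint (cb b • adSU2 (axialT U c b.src)⁻¹ n))
    (Ψ' : GaugeField P j SU2 → GaugeField P j SU2) (hΨ' : ∀ U b, Ψ' U b = if b ∈ S then (nf b U)⁻¹ * U b else U b)
    {t : ℝ} (ht : ∀ b ∈ S, |cb b| ≤ t) (ht0 : 0 ≤ t) (ht1 : t ≤ 1) (s D : Plaq P j → ℝ)
    (hs : ∀ q, s q = (if bond₁ q ∈ S then -cb (bond₁ q) else 0) + (if bond₂ q ∈ S then -cb (bond₂ q) else 0) -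
        (if bond₃ q ∈ S then -cb (bond₃ q) else 0) - (if bond₄ q ∈ S then -cb (bond₄ q) else 0))
    (hD : ∀ q, D q = 2 * ((if bond₁ q ∈ S then -cb (bond₁ q) else 0) ^ 2 + (if bond₂ q ∈ S then -cb (bond₂ q) else 0) ^ 2 +
          (if bond₃ q ∈ S then -cb (bond₃ q) else 0) ^ 2 + (if bond₄ q ∈ S then -cb (bond₄ q) else 0) ^ 2) +
        2 * (|(if bond₂ q ∈ S then -cb (bond₂ q) else 0)| * ((((2 * P.d * (r + 1) + 2 : ℕ) : ℝ) ^ 2 / 4) * θ) +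
          |(if bond₃ q ∈ S then -cb (bond₃ q) else 0)| * (3 * ((((2 * P.d * (r + 1) + 2 : ℕ) : ℝ) ^ 2 / 4) * θ)) +
          |(if bond₄ q ∈ S then -cb (bond₄ q) else 0)| * θ)) :
    (∑ q : Plaq P j,
        (-s q * ⟪n, imVec (su2Quat (GaugeField.plaqHol (GaugeField.gaugeAct (axialT V c) V) q))⟫ -
          D q * dist1 (GaugeField.plaqHol V q))) -
      (6 * t ^ 2 + 4 * t ^ 3 + t ^ 4) * ∑ q : Plaq P j, dist1 (GaugeField.plaqHol V q) -
      1 / 2 * ∑ q : Plaq P j, (|s q| + D q + (6 * t ^ 2 + 4 * t ^ 3 + t ^ 4)) ^ 2 ≤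
      wilsonAction4 V - wilsonAction4 (Ψ' V) := by
  rw [sweepInv_eq_mulField S nf Ψ' hΨ' V]
  have hE : ∀ b, (fun b => if b ∈ S then (nf b V)⁻¹ else (1 : SU2)) b =
      expPoint ((fun b => if b ∈ S then -cb b else 0) b • adSU2 (axialT V c b.src)⁻¹ n) := fun b =>
    combFactor_eq_expPoint c n cb S nf hnf V b
  have hcf : ∀ b, (fun b => if b ∈ S then -cb b else 0) b ≠ 0 →
      ∃ z : Fin P.d → ℤ, (∀ ν, (z ν).natAbs ≤ r) ∧ b.src = transl c z := by
    intro b hb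
    by_cases h : b ∈ S
    · exact hS b h
    · exact absurd (by simp [h]) hb
  have ht' : ∀ b, |(fun b => if b ∈ S then -cb b else 0) b| ≤ t := by
    intro b
    by_cases h : b ∈ S
    · simp only [h, if_true, abs_neg]; exact ht b h
    · simp only [h, if_false, abs_zero]; exact ht0
  exact comb_pairing_sub_le_wilsonAction4_sub_mulField hθ hV c hr hn _ _ hE hcf ht' ht1 s D hs hD

end Summit.QuantumFields.YangMills.Theorems.CovariantDischargeCombSweepLinCobd

end
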